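import Mathlib.Analysis.Distribution.SchwartzSpace.Basic
import Mathlib.Analysis.Calculus.Taylor
import Mathlib.Analysis.Calculus.IteratedDeriv.Lemmas
import HarnessLib

/-!
# Schwartz functions vanish to infinite order, with decay, off their support

Topic `Literature/Analysis/FunctionSpaces`; support file (all proved; no named facts). The
quantitative form of "a smooth function vanishes with all its derivatives at every point outside its
support", uniformly with Schwartz decay: for `F ∈ 𝓢(V)` and all `k, m` there is `C` with

  `(1 + ‖x‖)^m ‖F x‖ ≤ C ‖x − y‖^k`   for all `x` and all `y ∉ tsupport F`

(Taylor's formula along the segment `[y, x]`, at whose end point `y` all derivatives of `F` vanish).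
Used for the Euclidean restriction (4.4) of Osterwalder–Schrader II on *all* time-ordered test
functions: a Schwartz function supported in the open time-ordered region is bounded by any power of
the distance to the hyperplanes of coinciding times, which compensates the polynomial blow-up (4.5)
of the Schwinger functions there.

* `SchwartzMap.exists_pow_mul_norm_le_pow_dist` — the statement above.

## References

* K. Osterwalder, R. Schrader, *Axioms for Euclidean Green's functions II*, Comm. Math. Phys.
  42 (1975) 281–305, §IV.2 Thm. 4.1 (4.4)–(4.5). [OsterwalderSchraderCMP1975]
-/

noncomputable section

open Set Filter Metric
open _root_.Topology
open scoped SchwartzMap Nat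

namespace Literature.Analysis.FunctionSpaces

variable {V : Type*} [NormedAddCommGroup V] [NormedSpace ℝ V]

/-- The restriction of `F` to the line `t ↦ y + t v`: iterated derivatives. [folklore] -/
theorem norm_iteratedDeriv_comp_line_le (F : 𝓢(V, ℂ)) (y v : V) (n : ℕ) (t : ℝ) :
    ‖iteratedDeriv n (fun s : ℝ => F (y + s • v)) t‖ ≤ ‖iteratedFDeriv ℝ n (F : V → ℂ) (y + t • v)‖ * ‖v‖ ^ n := by
  -- `s ↦ y + s v` is the linear map `L s = s v` followed by the translation by `y`
  set L : ℝ →L[ℝ] V := ContinuousLinearMap.smulRight (1 : ℝ →L[ℝ] ℝ) v with hL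
  have hLapp : ∀ s : ℝ, L s = s • v := fun s => by simp [hL]
  have hcomp : (fun s : ℝ => F (y + s • v)) = (fun w : V => F (w + y)) ∘ L := by
    funext s; simp only [Function.comp_apply, hLapp, add_comm]
  have hFy : ContDiff ℝ n (fun w : V => (F : V → ℂ) (w + y)) := (F.smooth n).comp (contDiff_id.add contDiff_const)
  rw [iteratedDeriv_eq_iteratedFDeriv, hcomp, L.iteratedFDeriv_comp_right hFy t le_rfl,
    ContinuousMultilinearMap.compContinuousLinearMap_apply]
  have htr : iteratedFDeriv ℝ n (fun w : V => (F : V → ℂ) (w + y)) (L t) = iteratedFDeriv ℝ n (F : V → ℂ) (L t + y) :=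
    iteratedFDeriv_comp_add_right n y (L t)
  rw [htr, hLapp, add_comm (t • v) y]
  refine (ContinuousMultilinearMap.le_opNorm _ _).trans (le_of_eq ?_)
  congr 1
  simp [hLapp]

/-- **Schwartz functions vanish to infinite order, with decay, off their support — with the
Schwartz seminorm constant**: `(1 + ‖x‖)^m ‖F x‖ ≤ 4^m · sup_{(i,j) ≤ (m,k)} p_{i,j}(F) · ‖x − y‖^k`
for all `x` and all `y ∉ tsupport F`. [folklore] -/
theorem SchwartzMap.pow_mul_norm_le_seminorm_mul_pow_dist (F : 𝓢(V, ℂ)) (k m : ℕ) (x y : V)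
    (hy : y ∉ tsupport (F : V → ℂ)) :
    (1 + ‖x‖) ^ m * ‖F x‖ ≤
      (4 : ℝ) ^ m * (Finset.Iic (m, k)).sup (fun p => SchwartzMap.seminorm ℝ p.1 p.2) F * ‖x - y‖ ^ k := by
  set Smk : ℝ := (Finset.Iic (m, k)).sup (fun p => SchwartzMap.seminorm ℝ p.1 p.2) F with hSmk
  have hSmk0 : 0 ≤ Smk := by rw [hSmk]; exact apply_nonneg _ _
  -- the two Schwartz constants
  set C₀ : ℝ := 2 ^ m * Smk with hC₀def
  have hC₀0 : 0 ≤ C₀ := by positivity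
  have hC₀ : ∀ x : V, (1 + ‖x‖) ^ m * ‖F x‖ ≤ C₀ := fun x => by
    have h := SchwartzMap.one_add_le_sup_seminorm_apply (𝕜 := ℝ) (m := (m, k)) (k := m) (n := 0) le_rfl (Nat.zero_le _) F x
    rwa [norm_iteratedFDeriv_zero] at h
  set C₁ : ℝ := 2 ^ m * Smk with hC₁def
  have hC₁0 : 0 ≤ C₁ := by positivity
  have hC₁ : ∀ z : V, (1 + ‖z‖) ^ m * ‖iteratedFDeriv ℝ k (F : V → ℂ) z‖ ≤ C₁ := fun z =>
    SchwartzMap.one_add_le_sup_seminorm_apply (𝕜 := ℝ) (m := (m, k)) (k := m) (n := k) le_rfl le_rfl F z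
  have hmax : max C₀ (2 ^ m * C₁) ≤ (4 : ℝ) ^ m * Smk := by
    refine max_le ?_ ?_
    · rw [hC₀def]
      have : (2 : ℝ) ^ m ≤ 4 ^ m := pow_le_pow_left₀ (by norm_num) (by norm_num) m
      exact mul_le_mul_of_nonneg_right this hSmk0
    · rw [hC₁def, ← mul_assoc, ← mul_pow, show (2 : ℝ) * 2 = 4 by norm_num]
  refine le_trans ?_ (mul_le_mul_of_nonneg_right hmax (by positivity))
  -- far from `y`: the plain Schwartz bound
  rcases le_or_gt 1 ‖x - y‖ with hfar | hnear
  · calc (1 + ‖x‖) ^ m * ‖F x‖ ≤ C₀ := hC₀ x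
      _ ≤ C₀ * ‖x - y‖ ^ k := le_mul_of_one_le_right hC₀0 (one_le_pow₀ hfar)
      _ ≤ max C₀ (2 ^ m * C₁) * ‖x - y‖ ^ k := mul_le_mul_of_nonneg_right (le_max_left _ _) (by positivity)
  -- `k = 0`: nothing to prove
  cases k with
  | zero =>
    rw [pow_zero, mul_one]
    exact (hC₀ x).trans (le_max_left _ _)
  | succ n =>
  -- near `y`: Taylor along the segment
  set v : V := x - y with hv
  set g : ℝ → ℂ := fun s => F (y + s • v) with hg
  have hg1 : g 1 = F x := by simp [hg, hv]
  have hgs : ContDiff ℝ (⊤ : ℕ∞) g := (F.smooth ⊤).comp (contDiff_const.add (contDiff_id.smul contDiff_const))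
  have hle : ∀ j : ℕ, ((j : ℕ∞) : WithTop ℕ∞) ≤ ((⊤ : ℕ∞) : WithTop ℕ∞) := fun j => WithTop.coe_le_coe.2 le_top
  -- all derivatives of `g` vanish at `0`
  have hg0 : ∀ j : ℕ, iteratedDeriv j g 0 = 0 := by
    intro j
    have hF0 : (F : V → ℂ) =ᶠ[𝓝 y] 0 := notMem_tsupport_iff_eventuallyEq.1 hy
    have hcont : Tendsto (fun s : ℝ => y + s • v) (𝓝 0) (𝓝 y) := by
      have h : Continuous fun s : ℝ => y + s • v := continuous_const.add (continuous_id.smul continuous_const)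
      simpa using h.tendsto 0
    have hgev : g =ᶠ[𝓝 0] (fun _ => (0 : ℂ)) := hF0.comp_tendsto hcont
    rw [(hgev.iteratedDeriv j).eq_of_nhds]
    simp
  -- the Taylor polynomial at `0` vanishes
  have htaylor : taylorWithinEval g n (Icc 0 1) 0 1 = 0 := by
    rw [taylor_within_apply]
    refine Finset.sum_eq_zero fun j _ => ?_
    rw [iteratedDerivWithin_eq_iteratedDeriv (uniqueDiffOn_Icc one_pos) (hgs.contDiffAt.of_le (hle j))
      (left_mem_Icc.2 zero_le_one), hg0 j, smul_zero]
  -- the bound on the derivative of order `n + 1` along the segment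
  have hder : ∀ t ∈ Icc (0 : ℝ) 1, ‖iteratedDerivWithin (n + 1) g (Icc 0 1) t‖ ≤ 2 ^ m * C₁ * ‖v‖ ^ (n + 1) / (1 + ‖x‖) ^ m := by
    intro t ht
    rw [iteratedDerivWithin_eq_iteratedDeriv (uniqueDiffOn_Icc one_pos) (hgs.contDiffAt.of_le (hle (n + 1))) ht]
    have h1 := norm_iteratedDeriv_comp_line_le F y v (n + 1) t
    have hx1 : 0 < (1 + ‖x‖) ^ m := by positivity
    rw [le_div_iff₀ hx1]
    -- decay transfer: `1 + ‖x‖ ≤ 2 (1 + ‖y + t v‖)`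
    have hdist : ‖x - (y + t • v)‖ ≤ 1 := by
      have : x - (y + t • v) = (1 - t) • v := by rw [hv, sub_smul, one_smul]; abel
      rw [this, norm_smul, Real.norm_eq_abs, abs_of_nonneg (by linarith [ht.2])]
      calc (1 - t) * ‖v‖ ≤ 1 * ‖v‖ := mul_le_mul_of_nonneg_right (by linarith [ht.1]) (norm_nonneg _)
        _ ≤ 1 := by rw [one_mul]; exact hnear.le
    have hxle : 1 + ‖x‖ ≤ 2 * (1 + ‖y + t • v‖) := by
      have := norm_le_norm_add_norm_sub' x (y + t • v)   -- ‖x‖ ≤ ‖y + t v‖ + ‖x - (y + t v)‖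
      linarith [hdist, norm_nonneg (y + t • v)]
    have hpow : (1 + ‖x‖) ^ m ≤ 2 ^ m * (1 + ‖y + t • v‖) ^ m := by
      rw [← mul_pow]; exact pow_le_pow_left₀ (by positivity) hxle m
    calc ‖iteratedDeriv (n + 1) (fun s => F (y + s • v)) t‖ * (1 + ‖x‖) ^ m
        ≤ (‖iteratedFDeriv ℝ (n + 1) (F : V → ℂ) (y + t • v)‖ * ‖v‖ ^ (n + 1)) * (2 ^ m * (1 + ‖y + t • v‖) ^ m) :=
          mul_le_mul h1 hpow (by positivity) (by positivity)
      _ = 2 ^ m * ((1 + ‖y + t • v‖) ^ m * ‖iteratedFDeriv ℝ (n + 1) (F : V → ℂ) (y + t • v)‖) * ‖v‖ ^ (n + 1) := by ring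
      _ ≤ 2 ^ m * C₁ * ‖v‖ ^ (n + 1) := by
          have := hC₁ (y + t • v); gcongr
  -- Taylor's formula
  have hT := taylor_mean_remainder_bound (f := g) (a := 0) (b := 1) (x := 1) (n := n) zero_le_one
    (hgs.contDiffOn.of_le (by simpa using hle (n + 1))) (right_mem_Icc.2 zero_le_one) hder
  rw [htaylor, sub_zero, hg1, sub_zero, one_pow, mul_one] at hT
  -- conclude
  have hx1 : 0 < (1 + ‖x‖) ^ m := by positivity
  have hfact : (1 : ℝ) ≤ n ! := by exact_mod_cast Nat.one_le_iff_ne_zero.2 (Nat.factorial_ne_zero n)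
  calc (1 + ‖x‖) ^ m * ‖F x‖ ≤ (1 + ‖x‖) ^ m * (2 ^ m * C₁ * ‖v‖ ^ (n + 1) / (1 + ‖x‖) ^ m / n !) :=
        mul_le_mul_of_nonneg_left hT hx1.le
    _ = 2 ^ m * C₁ * ‖v‖ ^ (n + 1) / n ! := by field_simp
    _ ≤ 2 ^ m * C₁ * ‖v‖ ^ (n + 1) := div_le_self (by positivity) hfact
    _ ≤ max C₀ (2 ^ m * C₁) * ‖x - y‖ ^ (n + 1) := mul_le_mul_of_nonneg_right (le_max_right _ _) (by positivity)

/-- **Schwartz functions vanish to infinite order, with decay, off their support**: for all `k m`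
there is `C ≥ 0` with `(1 + ‖x‖)^m ‖F x‖ ≤ C ‖x − y‖^k` for all `x` and all `y ∉ tsupport F`. [folklore] -/
theorem SchwartzMap.exists_pow_mul_norm_le_pow_dist (F : 𝓢(V, ℂ)) (k m : ℕ) :
    ∃ C : ℝ, 0 ≤ C ∧ ∀ x y : V, y ∉ tsupport (F : V → ℂ) → (1 + ‖x‖) ^ m * ‖F x‖ ≤ C * ‖x - y‖ ^ k :=
  ⟨(4 : ℝ) ^ m * (Finset.Iic (m, k)).sup (fun p => SchwartzMap.seminorm ℝ p.1 p.2) F,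
    by have := apply_nonneg ((Finset.Iic (m, k)).sup (fun p => SchwartzMap.seminorm ℝ p.1 p.2)) F; positivity,
    fun x y hy => SchwartzMap.pow_mul_norm_le_seminorm_mul_pow_dist F k m x y hy⟩

end Literature.Analysis.FunctionSpaces
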